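import Mathlib.Tactic.Linarith
import Summits.CriticalPhenomena.PercolationContinuityZ3.Theorems.PercNearOneGluingNoHeavyLowerTailSahiCTCN2Monotone
import HarnessLib

/-!
# `NoHeavyLowerTail` (crux stmt-CriticalPhenomena-4575), P3 lane: the generic level-`c` certificate polynomial `Ñ_c = Ngen c` (g9 form (A))
# and its ANTITONICITY for general pairs of complexes (big faces, private small faces)

Support file (seat `prim-l12-p3`, gen 21; `--supports stmt-CriticalPhenomena-4575`).  Memo `run/shared/lean/prim/prim-l12/FROM-prim-l12-p3-g21-*.md`.
Companion of `…SahiCTCN2Monotone` (the case `c = 2`, `Ñ₂ = N2gen`), written uniformly in the threshold level `c`.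

For a level `c : ℕ` and families `K_X, K_Z ⊆ 2^α` put `h_K = GF(faces of size ≤ c)` (`facesLE`), `t_K = GF(faces of size > c)` (`facesGT`),
`h_Y` = common faces of size `≤ c` (`commonLE`), `e_Y` = common faces of size `= c` (`commonEQ`), `Θ_c` = all sets of size `≤ c` (`ThC`),
`D_c` = all sets of size `> c` (`DdC`), `e_c` = all `c`-sets (`ee c`), `Π` = all sets.  The generic certificate polynomial of memo g9 §1 (form (A)) is
  `Ñ_c(K_X,K_Z) := e_c(Π+D_c)(Π·h_Y − h_X·h_Z) − Θ_c·Π·D_c·e_Y − e_c·D_c·(h_X·t_Z + t_X·h_Z) + e_c·Θ_c·t_X·t_Z`   (`Ngen c`; `Ngen 2 = N2gen`, `Ngen_two`).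
By g9 §1, `Ñ_c(K_𝒳,K_𝒵)(r) ≥ 0` at the odds is the (TC) row of the level-`c` threshold certificate `ρ_c = μ(· | exactly c closed)` of the pattern event
`Th_{k−c}^k = {at most c closed}` (formal for `c = 2` in `…SahiAllButTwo`; for general `c` in the companion `…SahiAllButC`).  THIS FILE:
* `Ngen_erase_big` : for `S ∈ K_X`, `#S > c`: `Ñ_c(K_X∖S,K_Z) = Ñ_c(K_X,K_Z) + e_c·r^S·(D_c·h_Z − Θ_c·t_Z)`, and `D_c·h_Z − Θ_c·t_Z ∈ ℕ[r]` for a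
  down-set `K_Z` (`coeff_lymClassC_sub_nonneg`, weighted LYM across the classes `{≤ c} < {> c}`);
* `Ngen_erase_small` : for `S ∈ K_X`, `#S ≤ c`, `S ∉ K_Z`: `Ñ_c(K_X∖S,K_Z) = Ñ_c(K_X,K_Z) + e_c·r^S·((Π+D_c)·h_Z + D_c·t_Z)` (manifestly `≥ 0`);
* `coeff_Ngen_antitone_left/right` : enlarging `K_X` by sets that are big (`> c`) or not faces of `K_Z` LOWERS `Ñ_c` coefficientwise (and symmetrically).
The normal-form reduction for `c = 3` (configurations with 3-coloured pairs AND triangles) is in the companion `…SahiCTCN3NormalForm`.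
Nothing is asserted about the crux; no positivity of `Ñ_c` is claimed here.
-/

namespace Summit.CriticalPhenomena.PercolationContinuityZ3.Theorems.SahiCTCForms

open Finset MvPolynomial SahiCTCGenFun

variable {α : Type*} [DecidableEq α] [Fintype α]

/-! ### The level-`c` dictionary and `Ñ_c` -/

/-- Faces of size `≤ c` (`h_K`). [this work] -/
def facesLE (c : ℕ) (K : Finset (Finset α)) : Finset (Finset α) := univ.powerset.filter fun S => #S ≤ c ∧ S ∈ K

/-- Faces of size `> c` (`t_K`). [this work] -/
def facesGT (c : ℕ) (K : Finset (Finset α)) : Finset (Finset α) := univ.powerset.filter fun S => c < #S ∧ S ∈ K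

/-- Common faces of size `≤ c` (`h_Y`). [this work] -/
def commonLE (c : ℕ) (KX KZ : Finset (Finset α)) : Finset (Finset α) := univ.powerset.filter fun S => #S ≤ c ∧ S ∈ KX ∧ S ∈ KZ

/-- Common faces of size `= c` (`e_Y`). [this work] -/
def commonEQ (c : ℕ) (KX KZ : Finset (Finset α)) : Finset (Finset α) := univ.powerset.filter fun S => #S = c ∧ S ∈ KX ∧ S ∈ KZ

/-- `Θ_c = GF(sets of size ≤ c)`. [this work] -/
noncomputable def ThC (c : ℕ) : MvPolynomial α ℤ := gf (bySize (· ≤ c) : Finset (Finset α))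

/-- `D_c = GF(sets of size > c)`. [this work] -/
noncomputable def DdC (c : ℕ) : MvPolynomial α ℤ := gf (bySize (c < ·) : Finset (Finset α))

/-- **The generic level-`c` certificate polynomial `Ñ_c(K_X, K_Z)`** (memo g9 §1, form (A)). [this work] -/
noncomputable def Ngen (c : ℕ) (KX KZ : Finset (Finset α)) : MvPolynomial α ℤ :=
  ee c * (PiP + DdC c) * (PiP * gf (commonLE c KX KZ) - gf (facesLE c KX) * gf (facesLE c KZ))
    - ThC c * PiP * DdC c * gf (commonEQ c KX KZ)
    - ee c * DdC c * (gf (facesLE c KX) * gf (facesGT c KZ) + gf (facesGT c KX) * gf (facesLE c KZ))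
    + ee c * ThC c * gf (facesGT c KX) * gf (facesGT c KZ)

/-- `t_K` at level `2` is `bigFaces`. [this work] -/
theorem facesGT_two (K : Finset (Finset α)) : facesGT 2 K = bigFaces K := by
  ext S; simp only [facesGT, bigFaces, mem_filter]
  constructor
  · rintro ⟨h1, h2, h3⟩; exact ⟨h1, by omega, h3⟩
  · rintro ⟨h1, h2, h3⟩; exact ⟨h1, by omega, h3⟩

omit [DecidableEq α] in
/-- `D_2 = D` (`2 < n` is definitionally `3 ≤ n`). [this work] -/
theorem DdC_two : (DdC 2 : MvPolynomial α ℤ) = Dd := by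
  unfold DdC Dd bySize; congr 1

/-- **`Ñ₂` is the level-2 instance**: `Ngen 2 = N2gen`. [this work] -/
theorem Ngen_two (KX KZ : Finset (Finset α)) : Ngen 2 KX KZ = N2gen KX KZ := by
  unfold Ngen N2gen
  rw [facesGT_two, facesGT_two, DdC_two]
  rfl

/-- `h_Y` is symmetric. [this work] -/
theorem commonLE_comm (c : ℕ) (KX KZ : Finset (Finset α)) : commonLE c KX KZ = commonLE c KZ KX := by
  ext S; simp only [commonLE, mem_filter]; tauto

/-- `e_Y` is symmetric. [this work] -/
theorem commonEQ_comm (c : ℕ) (KX KZ : Finset (Finset α)) : commonEQ c KX KZ = commonEQ c KZ KX := by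
  ext S; simp only [commonEQ, mem_filter]; tauto

/-- `Ñ_c` is symmetric under `X ↔ Z`. [this work] -/
theorem Ngen_comm (c : ℕ) (KX KZ : Finset (Finset α)) : Ngen c KX KZ = Ngen c KZ KX := by
  unfold Ngen; rw [commonLE_comm c KZ KX, commonEQ_comm c KZ KX]; ring

/-- `h_K` as a filter of `K`. [this work] -/
theorem facesLE_eq_filter (c : ℕ) (K : Finset (Finset α)) : facesLE c K = K.filter fun S => #S ≤ c := by
  ext S; simp only [facesLE, mem_filter, mem_powerset]
  exact ⟨fun h => ⟨h.2.2, h.2.1⟩, fun h => ⟨subset_univ _, h.2, h.1⟩⟩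

/-- `t_K` as a filter of `K`. [this work] -/
theorem facesGT_eq_filter (c : ℕ) (K : Finset (Finset α)) : facesGT c K = K.filter fun S => c < #S := by
  ext S; simp only [facesGT, mem_filter, mem_powerset]
  exact ⟨fun h => ⟨h.2.2, h.2.1⟩, fun h => ⟨subset_univ _, h.2, h.1⟩⟩

/-- **Weighted LYM across the classes `{≤ c} < {> c}`**: for a down-set `K`, `D_c·h_K − Θ_c·t_K ∈ ℕ[r]`.  Sum of the single-level blocks
`coeff_downLYM_sub_nonneg`. [this work] -/
theorem coeff_lymClassC_sub_nonneg (c : ℕ) {K : Finset (Finset α)} (hK : IsLowerSet (K : Set (Finset α))) (n : α →₀ ℕ) :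
    0 ≤ (DdC c * gf (facesLE c K) - ThC c * gf (facesGT c K) : MvPolynomial α ℤ).coeff n := by
  have hKV : ∀ S ∈ K, S ⊆ (univ : Finset α) := fun S _ => subset_univ S
  have hVV : ∀ S ∈ (univ : Finset α).powerset, S ⊆ (univ : Finset α) := fun S _ => subset_univ S
  set R := range (#(univ : Finset α) + 1) with hR
  have e1 : (DdC c : MvPolynomial α ℤ) = ∑ j ∈ R.filter (fun j => c < j), gf (univ.powerset.filter fun P : Finset α => #P = j) := by
    unfold DdC bySize; exact gf_filter_card_eq_sum hVV (fun j => c < j)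
  have e2 : gf (facesLE c K) = ∑ d ∈ R.filter (fun d => d ≤ c), gf (K.filter fun S => #S = d) := by
    rw [facesLE_eq_filter]; exact gf_filter_card_eq_sum hKV (fun d => d ≤ c)
  have e3 : (ThC c : MvPolynomial α ℤ) = ∑ d ∈ R.filter (fun d => d ≤ c), gf (univ.powerset.filter fun P : Finset α => #P = d) := by
    unfold ThC bySize; exact gf_filter_card_eq_sum hVV (fun d => d ≤ c)
  have e4 : gf (facesGT c K) = ∑ j ∈ R.filter (fun j => c < j), gf (K.filter fun S => #S = j) := by
    rw [facesGT_eq_filter]; exact gf_filter_card_eq_sum hKV (fun j => c < j)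
  rw [e1, e2, e3, e4, sum_mul_sum, sum_mul_sum, sum_comm (s := R.filter (fun d => d ≤ c)), ← sum_sub_distrib, coeff_sum]
  refine sum_nonneg fun j hj => ?_
  rw [← sum_sub_distrib, coeff_sum]
  refine sum_nonneg fun d hd => ?_
  have hj2 := (mem_filter.1 hj).2
  have hd1 := (mem_filter.1 hd).2
  exact coeff_downLYM_sub_nonneg hK (show d ≤ j by omega) n

/-! ### Increment identities of `Ñ_c` under removal of one set from `K_X` -/

/-- Removing a big set does not change `h_K`. [this work] -/
theorem facesLE_erase_big {c : ℕ} {K : Finset (Finset α)} {S : Finset α} (hS : c < #S) : facesLE c (K.erase S) = facesLE c K := by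
  ext T; simp only [facesLE, mem_filter, mem_erase, ne_eq]
  constructor
  · rintro ⟨h1, h2, _, h3⟩; exact ⟨h1, h2, h3⟩
  · rintro ⟨h1, h2, h3⟩; exact ⟨h1, h2, by rintro rfl; omega, h3⟩

/-- Removing a big face `S` removes exactly `S` from `t_K`. [this work] -/
theorem facesGT_erase_big {c : ℕ} {K : Finset (Finset α)} {S : Finset α} (hSK : S ∈ K) (hS : c < #S) :
    facesGT c (K.erase S) = (facesGT c K).erase S ∧ S ∈ facesGT c K := by
  refine ⟨?_, mem_filter.2 ⟨mem_powerset.2 (subset_univ _), hS, hSK⟩⟩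
  ext T; simp only [facesGT, mem_filter, mem_erase, ne_eq]; tauto

/-- Removing a big set does not change `h_Y`, `e_Y`. [this work] -/
theorem commonFamilies_erase_big {c : ℕ} {K KZ : Finset (Finset α)} {S : Finset α} (hS : c < #S) :
    commonLE c (K.erase S) KZ = commonLE c K KZ ∧ commonEQ c (K.erase S) KZ = commonEQ c K KZ := by
  constructor
  · ext T; simp only [commonLE, mem_filter, mem_erase, ne_eq]
    constructor
    · rintro ⟨h1, h2, ⟨_, h3⟩, h4⟩; exact ⟨h1, h2, h3, h4⟩
    · rintro ⟨h1, h2, h3, h4⟩; exact ⟨h1, h2, ⟨by rintro rfl; omega, h3⟩, h4⟩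
  · ext T; simp only [commonEQ, mem_filter, mem_erase, ne_eq]
    constructor
    · rintro ⟨h1, h2, ⟨_, h3⟩, h4⟩; exact ⟨h1, h2, h3, h4⟩
    · rintro ⟨h1, h2, h3, h4⟩; exact ⟨h1, h2, ⟨by rintro rfl; omega, h3⟩, h4⟩

/-- **Big-set increment**: for `S ∈ K_X` with `#S > c`, `Ñ_c(K_X∖S, K_Z) = Ñ_c(K_X, K_Z) + e_c·r^S·(D_c·h_Z − Θ_c·t_Z)`. [this work] -/
theorem Ngen_erase_big {c : ℕ} {K KZ : Finset (Finset α)} {S : Finset α} (hSK : S ∈ K) (hS : c < #S) :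
    Ngen c (K.erase S) KZ = Ngen c K KZ + ee c * monomial (ind S) 1 * (DdC c * gf (facesLE c KZ) - ThC c * gf (facesGT c KZ)) := by
  obtain ⟨h1, h2⟩ := facesGT_erase_big hSK hS
  obtain ⟨h3, h4⟩ := commonFamilies_erase_big (K := K) (KZ := KZ) hS
  have hgf : gf (facesGT c K) = gf (facesGT c (K.erase S)) + monomial (ind S) 1 := by
    rw [h1]; unfold gf; rw [sum_erase_add _ _ h2]
  unfold Ngen
  rw [facesLE_erase_big hS, h3, h4, hgf]
  ring

/-- Removing a small set `S ∈ K` removes exactly `S` from `h_K`. [this work] -/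
theorem facesLE_erase_small {c : ℕ} {K : Finset (Finset α)} {S : Finset α} (hSK : S ∈ K) (hS : #S ≤ c) :
    facesLE c (K.erase S) = (facesLE c K).erase S ∧ S ∈ facesLE c K := by
  refine ⟨?_, mem_filter.2 ⟨mem_powerset.2 (subset_univ _), hS, hSK⟩⟩
  ext T; simp only [facesLE, mem_filter, mem_erase, ne_eq]; tauto

/-- Removing a small set does not change `t_K`. [this work] -/
theorem facesGT_erase_small {c : ℕ} {K : Finset (Finset α)} {S : Finset α} (hS : #S ≤ c) : facesGT c (K.erase S) = facesGT c K := by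
  ext T; simp only [facesGT, mem_filter, mem_erase, ne_eq]
  constructor
  · rintro ⟨h1, h2, _, h3⟩; exact ⟨h1, h2, h3⟩
  · rintro ⟨h1, h2, h3⟩; exact ⟨h1, h2, by rintro rfl; omega, h3⟩

/-- Removing a set that is not in `K_Z` does not change `h_Y`, `e_Y`. [this work] -/
theorem commonFamilies_erase_of_notMem' {c : ℕ} {K KZ : Finset (Finset α)} {S : Finset α} (hSZ : S ∉ KZ) :
    commonLE c (K.erase S) KZ = commonLE c K KZ ∧ commonEQ c (K.erase S) KZ = commonEQ c K KZ := by
  constructor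
  · ext T; simp only [commonLE, mem_filter, mem_erase, ne_eq]
    constructor
    · rintro ⟨h1, h2, ⟨_, h3⟩, h4⟩; exact ⟨h1, h2, h3, h4⟩
    · rintro ⟨h1, h2, h3, h4⟩; exact ⟨h1, h2, ⟨by rintro rfl; exact hSZ h4, h3⟩, h4⟩
  · ext T; simp only [commonEQ, mem_filter, mem_erase, ne_eq]
    constructor
    · rintro ⟨h1, h2, ⟨_, h3⟩, h4⟩; exact ⟨h1, h2, h3, h4⟩
    · rintro ⟨h1, h2, h3, h4⟩; exact ⟨h1, h2, ⟨by rintro rfl; exact hSZ h4, h3⟩, h4⟩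

/-- **Small-set increment**: for `S ∈ K_X` with `#S ≤ c` and `S ∉ K_Z`,
`Ñ_c(K_X∖S, K_Z) = Ñ_c(K_X, K_Z) + e_c·r^S·((Π+D_c)·h_Z + D_c·t_Z)`. [this work] -/
theorem Ngen_erase_small {c : ℕ} {K KZ : Finset (Finset α)} {S : Finset α} (hSK : S ∈ K) (hS : #S ≤ c) (hSZ : S ∉ KZ) :
    Ngen c (K.erase S) KZ = Ngen c K KZ + ee c * monomial (ind S) 1 * ((PiP + DdC c) * gf (facesLE c KZ) + DdC c * gf (facesGT c KZ)) := by
  obtain ⟨h1, h2⟩ := facesLE_erase_small hSK hS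
  obtain ⟨h3, h4⟩ := commonFamilies_erase_of_notMem' (c := c) (K := K) hSZ
  have hgf : gf (facesLE c K) = gf (facesLE c (K.erase S)) + monomial (ind S) 1 := by
    rw [h1]; unfold gf; rw [sum_erase_add _ _ h2]
  unfold Ngen
  rw [facesGT_erase_small hS, h3, h4, hgf]
  ring

/-- **One allowed removal raises `Ñ_c` coefficientwise**: `K_Z` a down-set, `S ∈ K_X` big or not a face of `K_Z`. [this work] -/
theorem coeff_Ngen_le_erase {c : ℕ} {K KZ : Finset (Finset α)} (hKZ : IsLowerSet (KZ : Set (Finset α))) {S : Finset α} (hSK : S ∈ K)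
    (h : c < #S ∨ S ∉ KZ) (n : α →₀ ℕ) : (Ngen c K KZ).coeff n ≤ (Ngen c (K.erase S) KZ).coeff n := by
  have hec : ∀ m, 0 ≤ (ee c : MvPolynomial α ℤ).coeff m := fun m => by unfold ee; exact coeff_gf_nonneg _ m
  by_cases hS : c < #S
  · rw [Ngen_erase_big hSK hS, mul_assoc, coeff_add]
    have := coeff_mul_nonneg hec (coeff_monomial_mul_nonneg S (coeff_lymClassC_sub_nonneg c hKZ)) n
    linarith
  · have hS2 : #S ≤ c := by omega
    have hSZ : S ∉ KZ := h.resolve_left hS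
    rw [Ngen_erase_small hSK hS2 hSZ, mul_assoc, coeff_add]
    have hPi : ∀ m, 0 ≤ (PiP : MvPolynomial α ℤ).coeff m := fun m => by unfold PiP; exact coeff_gf_nonneg _ m
    have hDd : ∀ m, 0 ≤ (DdC c : MvPolynomial α ℤ).coeff m := fun m => by unfold DdC; exact coeff_gf_nonneg _ m
    have hB : ∀ m, 0 ≤ ((PiP + DdC c) * gf (facesLE c KZ) + DdC c * gf (facesGT c KZ) : MvPolynomial α ℤ).coeff m :=
      cw_add (cw_mul (cw_add hPi hDd) (coeff_gf_nonneg _)) (cw_mul hDd (coeff_gf_nonneg _))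
    have := coeff_mul_nonneg hec (coeff_monomial_mul_nonneg S hB) n
    linarith

/-- **`Ñ_c` is antitone in `K_X` along allowed enlargements**: if `K_Z` is a down-set, `K_X⁰ ⊆ K_X` and every set of `K_X ∖ K_X⁰` has size
`> c` or is not in `K_Z`, then `Ñ_c(K_X, K_Z) ≤ Ñ_c(K_X⁰, K_Z)` coefficientwise. [this work] -/
theorem coeff_Ngen_antitone_left {c : ℕ} {KZ : Finset (Finset α)} (hKZ : IsLowerSet (KZ : Set (Finset α))) :
    ∀ (k : ℕ) (KX₀ KX : Finset (Finset α)), #(KX \ KX₀) = k → KX₀ ⊆ KX → (∀ S ∈ KX, S ∉ KX₀ → c < #S ∨ S ∉ KZ) →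
      ∀ n : α →₀ ℕ, (Ngen c KX KZ).coeff n ≤ (Ngen c KX₀ KZ).coeff n := by
  intro k
  induction k with
  | zero =>
    intro KX₀ KX hk hsub _ n
    have : KX = KX₀ := Subset.antisymm (Finset.sdiff_eq_empty_iff_subset.1 (card_eq_zero.1 hk)) hsub
    rw [this]
  | succ k ih =>
    intro KX₀ KX hk hsub hdiff n
    obtain ⟨S, hS⟩ : (KX \ KX₀).Nonempty := card_pos.1 (by omega)
    obtain ⟨hSK, hS0⟩ := mem_sdiff.1 hS
    have hstep := coeff_Ngen_le_erase hKZ hSK (hdiff S hSK hS0) n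
    have hk' : #(KX.erase S \ KX₀) = k := by
      have : KX.erase S \ KX₀ = (KX \ KX₀).erase S := by ext T; simp only [mem_sdiff, mem_erase]; tauto
      rw [this, card_erase_of_mem hS, hk]; rfl
    have hsub' : KX₀ ⊆ KX.erase S := fun T hT => mem_erase.2 ⟨fun h => hS0 (h ▸ hT), hsub hT⟩
    have hdiff' : ∀ T ∈ KX.erase S, T ∉ KX₀ → c < #T ∨ T ∉ KZ := fun T hT hT0 => hdiff T (mem_of_mem_erase hT) hT0
    exact hstep.trans (ih KX₀ (KX.erase S) hk' hsub' hdiff' n)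

/-- Antitonicity in `K_Z` (by the symmetry `Ngen_comm`), `K_X` a down-set. [this work] -/
theorem coeff_Ngen_antitone_right {c : ℕ} {KX KZ₀ KZ : Finset (Finset α)} (hKX : IsLowerSet (KX : Set (Finset α))) (hsub : KZ₀ ⊆ KZ)
    (hdiff : ∀ S ∈ KZ, S ∉ KZ₀ → c < #S ∨ S ∉ KX) (n : α →₀ ℕ) :
    (Ngen c KX KZ).coeff n ≤ (Ngen c KX KZ₀).coeff n := by
  rw [Ngen_comm c KX KZ, Ngen_comm c KX KZ₀]
  exact coeff_Ngen_antitone_left hKX _ KZ₀ KZ rfl hsub hdiff n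

end Summit.CriticalPhenomena.PercolationContinuityZ3.Theorems.SahiCTCForms
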